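import Literature.AlgebraicGeometry.Motives.AbelianVarietyPermutationPowerTateHom
import Literature.RepresentationTheory.FiniteGroups.DoubleCosetOrbits
import HarnessLib

/-!
# Mackey's double-coset count for coset powers, and the regular power:
# `rk_ℤ Hom_G(A^{G/H}, B^{G/K}) = |H\G/K| · rk_ℤ Hom(A, B)`, `dim B_H(A^{G/K}) = |H\G/K| · dim A = dim B_K(A^{G/H})`,
# `rk_ℤ Hom_G(X, A^G) = rk_ℤ Hom(X, A)`, `rk_ℤ End_G(A^G) = |G| · rk_ℤ End A`

The orbit counts that the permutation-power files leave symbolic (`|G\(S × T)|`, `|H\S|`,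
`Motives/AbelianVarietyPermutationPowerHom`, `…Character`, `…TateHom`) are evaluated for COSET SPACES:

* §1 (group theory) **`|G\(X × Y)| = |Stab(x₀)\Y|`** for a transitive finite `G`-set `X ∋ x₀` (Burnside on `X × Y`,
  `|(X × Y)^g| = |X^g| |Y^g|`, `|H| |X^g| = m_H(g)` and Frobenius reciprocity in counting form for the class function
  `g ↦ |Y^g|`; Isaacs Cor. 5.16 / James–Liebeck 29.8 is the case `Y = X`; for `X = G/H` the tree's `orbitRelQuotientEquivProd`
  of `RepresentationTheory/FiniteGroups/DoubleCosetOrbits` is the explicit bijection), the trivial subgroup has `|Y|` orbits, the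
  regular `G`-set has `|G\(G × Y)| = |Y|`; the identifications **`|G\(G/H × G/K)| = |H\(G/K)| = |H\G/K| = |K\G/H|`** are the
  tree's `natCard_orbitRel_prod_eq_natCard_doubleCoset`, `natCard_doubleCoset_eq_natCard_orbitRel`, `natCard_doubleCoset_comm`
  (`DoubleCosetOrbits`, Ceccherini-Silberstein–Scarabotti–Tolli Ex. 10.4.15; Serre §7.3: "`s ∈ S ≃ K\G/H`");
* §2 (Mackey for powers, Serre §7.3 Prop. 22 and §7.4: `⟨Ind_H^G 1, Ind_K^G 1⟩_G = |H\G/K|`):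
  **`rk_ℤ Hom_G(A^{G/H}, B^{G/K}) = |H\G/K| · rk_ℤ Hom(A, B)`** (`finrank_equivariantHom_cosetPowers_eq`), the Hecke-algebra rank
  **`rk_ℤ End_G(A^{G/H}) = |H\G/H| · rk_ℤ End A`**, **`dim B_H(A^{G/K}) = |H\G/K| · dim A`** and its symmetry
  **`dim B_H(A^{G/K}) = dim B_K(A^{G/H})`**, and `rk_{ℤ_ℓ} Hom_{ℤ_ℓ[G]}(T_ℓ A^{G/H}, T_ℓ B^{G/K}) = |H\G/K| · 4 dim A dim B`;
* §3 (the REGULAR power `A^G = A ⊗ ℤ[G]`, `H = 1`): **`rk_ℤ Hom_G(X, A^G) = rk_ℤ Hom(X, A)`** and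
  **`rk_ℤ Hom_G(A^G, Y) = rk_ℤ Hom(A, Y)`** for arbitrary actions on `X`, `Y` (Frobenius reciprocity with the trivial
  subgroup: `A ⊗ ℤ[G]` is induced AND co-induced from `A`), **`rk_ℤ End_G(A^G) = |G| · rk_ℤ End A`**
  (`End_G(A ⊗ ℤ[G]) ⊇ End(A) ⊗ ℤ[G]^{op}` with equality of ranks), `rk_ℤ Hom_G(A^G, B^{G/K}) = [G : K] · rk Hom(A, B)`.

Everything is a theorem (no definitions).  Conventions: `G ⧸ H` are Mathlib's left cosets with `g • xH = gxH`;
`H\G/K = DoubleCoset.Quotient H K`; the regular `G`-set is `G` with `g • x = g x`.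

## References

* [SerreLinearRepresentations1977] J.-P. Serre, *Linear Representations of Finite Groups*, GTM 42 (1977): §3.3 Ex. 2, §7.2
  Thm. 13, §7.3 Prop. 22 ("representatives `S` for the `(H, K)` double cosets … `s ∈ K\G/H`") and §7.4 (proof of Prop. 23:
  `⟨V, V⟩_G = Σ_{s ∈ H\G/H} d_s`).  Held: `book:serre1977-linear-representations-finite-groups`, pp. 30, 51–54 read.
* [Isaacs1976] I. M. Isaacs, *Character Theory of Finite Groups* (1976), Cor. 5.15 (Burnside), Cor. 5.16 (orbits of `G` on
  `Ω × Ω` = orbits of `G_α` on `Ω`), Thm. 5.18.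
* [CeccherinisilbersteScarabottiTolli2018] T. Ceccherini-Silberstein, F. Scarabotti, F. Tolli, *Discrete Harmonic Analysis* (2018),
  §10.4 Exercise 10.4.15 (1) (the tree's `RepresentationTheory/FiniteGroups/DoubleCosetOrbits`).
* [JordanEtAl2018] B. W. Jordan et al., *Abelian varieties isogenous to a power of an elliptic curve*, Compos. Math. 154 (2018),
  §4.1 (`𝓗𝓞𝓜_R(R, E) = E`: the regular power represents `Hom(−, A)`).
* [MumfordAV1970] D. Mumford, *Abelian Varieties* (1970), §19 Thm. 3 and Cor. 1 (pp. 176–178).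
-/

noncomputable section

open CategoryTheory CategoryTheory.Limits MulAction
open Literature.RepresentationTheory.FiniteGroups
open Literature.NumberTheory.DiophantineGeometry

universe u

namespace Literature.AlgebraicGeometry.Motives

namespace AbelianVariety

variable {K : Type u} [Field K]

/-! ## §1 Orbit counts: `|G\(X × Y)| = |Stab(x₀)\Y|`, `|1\Y| = |Y|`, `|G\(G × Y)| = |Y|` -/

section OrbitCounts

variable {G : Type} [Group G]

/-- **`|G\(X × Y)| = |Stab_G(x₀)\Y|` for a transitive finite `G`-set `X ∋ x₀`** and any finite `G`-set `Y` (`G` finite):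
`|G| · |G\(X × Y)| = Σ_g |X^g| |Y^g|` (Burnside), `|H| |X^g| = m_H(g)` (marks of `H = Stab(x₀)`), and
`Σ_g m_H(g) |Y^g| = |G| Σ_{h ∈ H} |Y^h| = |G| |H| |H\Y|` (Frobenius reciprocity in counting form for the class function
`g ↦ |Y^g|`, then Burnside for `H`).  For `Y = X`: the rank of a transitive action (Isaacs Cor. 5.16).
[cite: Isaacs1976, Cor. 5.15 and Cor. 5.16] [cite: SerreLinearRepresentations1977, §2.3 Ex. 2.6 (b) and §7.2 Thm. 13] -/
theorem natCard_quotient_orbitRel_prod_eq_of_isPretransitive [Fintype G] {X Y : Type} [Fintype X] [Fintype Y]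
    [MulAction G X] [MulAction G Y] [IsPretransitive G X] (x₀ : X) {H : Subgroup G} (hH : stabilizer G x₀ = H) :
    Nat.card (Quotient (orbitRel G (X × Y))) = Nat.card (Quotient (orbitRel H Y)) := by
  classical
  haveI : Fintype H := Fintype.ofFinite H
  -- `|G| |G\(X × Y)| = Σ_g |X^g| |Y^g|`
  have h1 : Nat.card (Quotient (orbitRel G (X × Y))) * Fintype.card G =
      ∑ g : G, (fixedBy X g).ncard * (fixedBy Y g).ncard := by
    rw [← sum_natCard_fixedBy (G := G) (Ω := X × Y)]
    exact Finset.sum_congr rfl fun g _ ↦ by rw [Nat.card_coe_set_eq, ncard_fixedBy_prod]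
  -- `g ↦ |Y^g|` is a class function
  have hcl : ∀ a g : G, (fixedBy Y (a * g * a⁻¹)).ncard = (fixedBy Y g).ncard := fun a g ↦ by
    rw [← smul_fixedBy Y g a, Set.ncard_smul_set]
  -- Frobenius reciprocity in counting form
  have hFR := card_smul_sum_subgroup_eq_sum_card_conj_smul H (fun g ↦ (fixedBy Y g).ncard) hcl
  simp only [smul_eq_mul] at hFR
  -- `|H| Σ_g |X^g| |Y^g| = Σ_g m_H(g) |Y^g|`
  have h2 : Nat.card H * ∑ g : G, (fixedBy X g).ncard * (fixedBy Y g).ncard =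
      ∑ g : G, Nat.card {x : G // x⁻¹ * g * x ∈ H} * (fixedBy Y g).ncard := by
    rw [Finset.mul_sum]
    exact Finset.sum_congr rfl fun g _ ↦ by
      rw [← mul_assoc, natCard_mul_ncard_fixedBy_eq_natCard_conj_mem x₀ hH g]
  -- Burnside for `H` on `Y`
  have h3 : ∑ h : H, (fixedBy Y (h : G)).ncard = Nat.card (Quotient (orbitRel H Y)) * Fintype.card H := by
    rw [← sum_natCard_fixedBy (G := H) (Ω := Y)]
    exact Finset.sum_congr rfl fun h _ ↦ by rw [Nat.card_coe_set_eq]; rfl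
  have hH0 : 0 < Nat.card H := Nat.card_pos
  have hG0 : 0 < Fintype.card G := Fintype.card_pos
  apply Nat.eq_of_mul_eq_mul_left hH0
  apply Nat.eq_of_mul_eq_mul_right hG0
  rw [mul_assoc, h1, h2, ← hFR, h3]
  simp only [Nat.card_eq_fintype_card]
  ring

omit [Group G] in
/-- **The trivial group has `|Y|` orbits**: for a subsingleton group acting on `Y` every orbit is a point.
[cite: SerreLinearRepresentations1977, §2.3 Ex. 2.6 (a)] -/
theorem natCard_quotient_orbitRel_eq_of_subsingleton {L : Type} [Group L] [Subsingleton L] {Y : Type} [MulAction L Y] :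
    Nat.card (Quotient (orbitRel L Y)) = Nat.card Y := by
  refine (Nat.card_congr (Equiv.ofBijective (Quotient.mk (orbitRel L Y)) ⟨fun y y' h ↦ ?_, fun q ↦ ?_⟩)).symm
  · obtain ⟨l, hl⟩ := MulAction.mem_orbit_iff.1 (MulAction.orbitRel_apply.1 (Quotient.eq.1 h))
    rw [← hl, Subsingleton.elim l 1, one_smul]
  · exact Quotient.inductionOn q fun y ↦ ⟨y, rfl⟩

/-- **`|G\(G × Y)| = |Y|`** for the regular `G`-set `G` (free and transitive) and any finite `G`-set `Y` (`G` finite).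
[cite: SerreLinearRepresentations1977, §1.2 (b) and §2.3 Ex. 2.6] -/
theorem natCard_quotient_orbitRel_regular_prod_eq [Fintype G] {Y : Type} [Fintype Y] [MulAction G Y] :
    Nat.card (Quotient (orbitRel G (G × Y))) = Nat.card Y := by
  rw [natCard_quotient_orbitRel_prod_eq_of_isPretransitive (1 : G) (IsCancelSMul.stabilizer_eq_bot (1 : G))]
  exact natCard_quotient_orbitRel_eq_of_subsingleton

end OrbitCounts

/-! ## §2 Mackey for coset powers: `rk Hom_G(A^{G/H}, B^{G/K}) = |H\G/K| · rk Hom(A, B)`, `dim B_H(A^{G/K}) = |H\G/K| · dim A` -/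

section Mackey

variable {A B : AbelianVariety K} {G : Type} [Group G] (H L : Subgroup G) [Fintype (G ⧸ H)] [Fintype (G ⧸ L)]
  (b : Bicone (fun _ : G ⧸ H ↦ A)) (c : Bicone (fun _ : G ⧸ L ↦ B)) (ρ : G →* End b.pt) (ρc : G →* End c.pt)

/-- **Mackey's count for coset powers: `rk_ℤ Hom_G(A^{G/H}, B^{G/K}) = |H\G/K| · rk_ℤ Hom(A, B)`** (`G` finite): equivariant
homomorphisms between the induced powers are orbit matrices on `G/H × G/K`, i.e. functions on the double cosets
(`⟨Ind_H^G 1, Ind_K^G 1⟩ = |H\G/K|`). [cite: SerreLinearRepresentations1977, §7.3 Prop. 22 and §7.4] [cite: MumfordAV1970, §19 Thm. 3 (p. 176)] -/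
theorem finrank_equivariantHom_cosetPowers_eq [Fintype G] (hb : ∑ t, b.π t ≫ b.ι t = 𝟙 b.pt)
    (hc : ∑ t, c.π t ≫ c.ι t = 𝟙 c.pt) (hρ : ∀ (g : G) (t : G ⧸ H), b.ι t ≫ End.asHom (ρ g) = b.ι (g • t))
    (hρc : ∀ (g : G) (t : G ⧸ L), c.ι t ≫ End.asHom (ρc g) = c.ι (g • t)) :
    Module.finrank ℤ (⨅ g : G, LinearMap.eqLocus (Preadditive.leftComp c.pt (End.asHom (ρ g))).toIntLinearMap
        (Preadditive.rightComp b.pt (End.asHom (ρc g))).toIntLinearMap : Submodule ℤ (b.pt ⟶ c.pt)) =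
      Nat.card (DoubleCoset.Quotient (H : Set G) (L : Set G)) * Module.finrank ℤ (A ⟶ B) := by
  rw [finrank_equivariantHom_permPower_eq b c ρ ρc hb hc hρ hρc]
  exact congrArg (· * Module.finrank ℤ (A ⟶ B)) (natCard_orbitRel_prod_eq_natCard_doubleCoset H L)

/-- **The Hecke-algebra rank: `rk_ℤ End_G(A^{G/H}) = |H\G/H| · rk_ℤ End A`** (`G` finite): the commutant of the induced power is
spanned over `End A` by the double-coset operators `T_{HgH}`. [cite: SerreLinearRepresentations1977, §7.4 (proof of Prop. 23)]
[cite: MumfordAV1970, §19 Thm. 3 (p. 176)] -/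
theorem finrank_equivariantEnd_cosetPower_eq [Fintype G] (hb : ∑ t, b.π t ≫ b.ι t = 𝟙 b.pt)
    (hρ : ∀ (g : G) (t : G ⧸ H), b.ι t ≫ End.asHom (ρ g) = b.ι (g • t)) :
    Module.finrank ℤ (⨅ g : G, LinearMap.eqLocus (Preadditive.leftComp b.pt (End.asHom (ρ g))).toIntLinearMap
        (Preadditive.rightComp b.pt (End.asHom (ρ g))).toIntLinearMap : Submodule ℤ (b.pt ⟶ b.pt)) =
      Nat.card (DoubleCoset.Quotient (H : Set G) (H : Set G)) * Module.finrank ℤ (A ⟶ A) :=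
  finrank_equivariantHom_cosetPowers_eq H H b b ρ ρ hb hb hρ hρ

omit [Fintype (G ⧸ H)] in
/-- **`dim B_H(A^{G/K}) = |H\G/K| · dim A`** for a finite subgroup `H` acting on the coset power `A^{G/K}` through the permutation
action (`N_H = Σ_{h ∈ H} ρ(h)`, `B_H = Im N_H`): Burnside's count with `|H\(G/K)| = |H\G/K|`.
[cite: SerreLinearRepresentations1977, §7.3 Prop. 22] [cite: KaniRosen1989, §3 Thm. B] [cite: LangeRodriguez2022, §2.9.1 Prop. 2.9.3 (PDF p. 46)] -/
theorem dim_image_norm_cosetPower_eq [Fintype H] (hc : ∑ t, c.π t ≫ c.ι t = 𝟙 c.pt)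
    (hρc : ∀ (g : G) (t : G ⧸ L), c.ι t ≫ End.asHom (ρc g) = c.ι (g • t)) {N : c.pt ⟶ c.pt}
    (hN : End.of N = ∑ h : H, ρc h) :
    (image N).dim = Nat.card (DoubleCoset.Quotient (H : Set G) (L : Set G)) * B.dim := by
  rw [dim_image_norm_permAction_eq c ρc hc hρc hN]
  exact congrArg (· * B.dim) (natCard_doubleCoset_eq_natCard_orbitRel H L).symm

/-- **Symmetry `dim B_H(A^{G/K}) = dim B_K(A^{G/H})`** for finite subgroups `H`, `K` and the two coset powers of ONE abelian
variety `A` (`|H\G/K| = |K\G/H|`; `⟨Ind_H 1, Ind_K 1⟩` is symmetric). [cite: SerreLinearRepresentations1977, §7.3 Prop. 22 and §7.2 Thm. 13]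
[cite: KaniRosen1989, §3 Thm. B] -/
theorem dim_image_norm_cosetPower_comm [Fintype H] [Fintype L] (b' : Bicone (fun _ : G ⧸ H ↦ A))
    (c' : Bicone (fun _ : G ⧸ L ↦ A)) (ρb : G →* End b'.pt) (ρc' : G →* End c'.pt)
    (hb : ∑ t, b'.π t ≫ b'.ι t = 𝟙 b'.pt) (hc : ∑ t, c'.π t ≫ c'.ι t = 𝟙 c'.pt)
    (hρb : ∀ (g : G) (t : G ⧸ H), b'.ι t ≫ End.asHom (ρb g) = b'.ι (g • t))
    (hρc' : ∀ (g : G) (t : G ⧸ L), c'.ι t ≫ End.asHom (ρc' g) = c'.ι (g • t))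
    {N : c'.pt ⟶ c'.pt} (hN : End.of N = ∑ h : H, ρc' h) {N' : b'.pt ⟶ b'.pt} (hN' : End.of N' = ∑ k : L, ρb k) :
    (image N).dim = (image N').dim := by
  rw [dim_image_norm_cosetPower_eq H L c' ρc' hc hρc' hN, dim_image_norm_cosetPower_eq L H b' ρb hb hρb hN',
    natCard_doubleCoset_comm H L]

/-- **`rk_{ℤ_ℓ} Hom_{ℤ_ℓ[G]}(T_ℓ A^{G/H}, T_ℓ B^{G/K}) = |H\G/K| · 4 dim A dim B`** (`G` finite, `ℓ` invertible in `K`).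
[cite: SerreLinearRepresentations1977, §7.3 Prop. 22 and §7.4] [cite: MumfordAV1970, §19 Thm. 4 (p. 180)] -/
theorem finrank_equivariantTateHom_cosetPowers_eq [Fintype G] (ℓ : ℕ) [Fact ℓ.Prime]
    (hb : ∑ t, b.π t ≫ b.ι t = 𝟙 b.pt) (hc : ∑ t, c.π t ≫ c.ι t = 𝟙 c.pt)
    (hρ : ∀ (g : G) (t : G ⧸ H), b.ι t ≫ End.asHom (ρ g) = b.ι (g • t))
    (hρc : ∀ (g : G) (t : G ⧸ L), c.ι t ≫ End.asHom (ρc g) = c.ι (g • t)) (hℓ : (ℓ : K) ≠ 0) :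
    Module.finrank ℤ_[ℓ]
        (⨅ g : G, LinearMap.eqLocus (LinearMap.llcomp ℤ_[ℓ] _ _ _ (tateModuleMap ℓ (End.asHom (ρc g))))
          (LinearMap.lcomp ℤ_[ℓ] _ (tateModuleMap ℓ (End.asHom (ρ g)))) :
            Submodule ℤ_[ℓ] (b.pt.tateModule ℓ →ₗ[ℤ_[ℓ]] c.pt.tateModule ℓ)) =
      Nat.card (DoubleCoset.Quotient (H : Set G) (L : Set G)) * (4 * A.dim * B.dim) := by
  rw [finrank_equivariantTateHom_permPower_eq ℓ b c ρ ρc hb hc hρ hρc hℓ]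
  exact congrArg (· * (4 * A.dim * B.dim)) (natCard_orbitRel_prod_eq_natCard_doubleCoset H L)

end Mackey

/-! ## §3 The regular power `A^G = A ⊗ ℤ[G]` -/

section Regular

variable {A B X Y : AbelianVariety K} {G : Type} [Group G] [Fintype G] (b : Bicone (fun _ : G ↦ A))
  (ρ : G →* End b.pt) (ρ' : G →* End X) (ρY : G →* End Y)

/-- **`rk_ℤ Hom_G(X, A^G) = rk_ℤ Hom(X, A)`** for the regular power (`ι_x ≫ ρ(g) = ι_{gx}`) and ANY action `ρ'` on `X`:
Frobenius reciprocity with the trivial subgroup — `A ⊗ ℤ[G]` is co-induced from `A`, `Hom_G(X, A ⊗ ℤ[G]) = Hom(X, A)`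
(`𝓗𝓞𝓜_R(R, E) = E` represents `Hom(−, E)`). [cite: SerreLinearRepresentations1977, §7.2 Thm. 13 and §3.3 Ex. 2]
[cite: JordanEtAl2018, §4.1 (`𝓗𝓞𝓜_R(R, E) = E`)] -/
theorem finrank_equivariantHom_regularPower_target_eq (hb : ∑ x, b.π x ≫ b.ι x = 𝟙 b.pt)
    (hρ : ∀ (g : G) (x : G), b.ι x ≫ End.asHom (ρ g) = b.ι (g • x)) :
    Module.finrank ℤ (⨅ g : G, LinearMap.eqLocus (Preadditive.leftComp b.pt (End.asHom (ρ' g))).toIntLinearMap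
        (Preadditive.rightComp X (End.asHom (ρ g))).toIntLinearMap : Submodule ℤ (X ⟶ b.pt)) =
      Module.finrank ℤ (X ⟶ A) := by
  rw [finrank_equivariantHom_permPower_target_eq b ρ ρ' (1 : G) hb hρ, IsCancelSMul.stabilizer_eq_bot]
  have htop : (⨅ h : (⊥ : Subgroup G), LinearMap.eqLocus (Preadditive.leftComp A (End.asHom (ρ' h))).toIntLinearMap
      LinearMap.id : Submodule ℤ (X ⟶ A)) = ⊤ := by
    refine eq_top_iff.2 fun u _ ↦ ?_
    rw [Submodule.mem_iInf]
    rintro ⟨h, hh⟩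
    rw [Subgroup.mem_bot] at hh
    subst hh
    refine LinearMap.mem_eqLocus.2 ?_
    change End.asHom (ρ' 1) ≫ u = u
    rw [asHom_map_one_eq_id, Category.id_comp]
  rw [htop, finrank_top]

/-- **`rk_ℤ Hom_G(A^G, Y) = rk_ℤ Hom(A, Y)`** for the regular power and ANY action `ρ_Y` on `Y`: `A ⊗ ℤ[G]` is induced from `A`,
`Hom_G(A ⊗ ℤ[G], Y) = Hom(A, Y)`. [cite: SerreLinearRepresentations1977, §7.2 Thm. 13 and §3.3 Ex. 2]
[cite: JordanEtAl2018, §4.1 and Remark 4.1] -/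
theorem finrank_equivariantHom_regularPower_source_eq (hb : ∑ x, b.π x ≫ b.ι x = 𝟙 b.pt)
    (hρ : ∀ (g : G) (x : G), b.ι x ≫ End.asHom (ρ g) = b.ι (g • x)) :
    Module.finrank ℤ (⨅ g : G, LinearMap.eqLocus (Preadditive.leftComp Y (End.asHom (ρ g))).toIntLinearMap
        (Preadditive.rightComp b.pt (End.asHom (ρY g))).toIntLinearMap : Submodule ℤ (b.pt ⟶ Y)) =
      Module.finrank ℤ (A ⟶ Y) := by
  rw [finrank_equivariantHom_permPower_source_eq b ρ ρY (1 : G) hb hρ, IsCancelSMul.stabilizer_eq_bot]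
  have htop : (⨅ h : (⊥ : Subgroup G), LinearMap.eqLocus (Preadditive.rightComp A (End.asHom (ρY h))).toIntLinearMap
      LinearMap.id : Submodule ℤ (A ⟶ Y)) = ⊤ := by
    refine eq_top_iff.2 fun v _ ↦ ?_
    rw [Submodule.mem_iInf]
    rintro ⟨h, hh⟩
    rw [Subgroup.mem_bot] at hh
    subst hh
    refine LinearMap.mem_eqLocus.2 ?_
    change v ≫ End.asHom (ρY 1) = v
    rw [asHom_map_one_eq_id, Category.comp_id]
  rw [htop, finrank_top]

/-- **`rk_ℤ End_G(A^G) = |G| · rk_ℤ End A`** for the regular power: `End_G(A ⊗ ℤ[G]) = Hom(A, A ⊗ ℤ[G]) = End(A)^G` as groups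
(`|G\(G × G)| = |G|` orbit matrices; the commutant contains `End(A) ⊗ ℤ[G]^{op}` with the same rank).
[cite: SerreLinearRepresentations1977, §7.4 (proof of Prop. 23) and §1.2 (b)] [cite: MumfordAV1970, §19 Thm. 3 (p. 176)] -/
theorem finrank_equivariantEnd_regularPower_eq (hb : ∑ x, b.π x ≫ b.ι x = 𝟙 b.pt)
    (hρ : ∀ (g : G) (x : G), b.ι x ≫ End.asHom (ρ g) = b.ι (g • x)) :
    Module.finrank ℤ (⨅ g : G, LinearMap.eqLocus (Preadditive.leftComp b.pt (End.asHom (ρ g))).toIntLinearMap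
        (Preadditive.rightComp b.pt (End.asHom (ρ g))).toIntLinearMap : Submodule ℤ (b.pt ⟶ b.pt)) =
      Nat.card G * Module.finrank ℤ (A ⟶ A) := by
  rw [finrank_equivariantHom_permPower_eq b b ρ ρ hb hb hρ hρ, natCard_quotient_orbitRel_regular_prod_eq]

variable {T : Type} [Fintype T] [MulAction G T] (c : Bicone (fun _ : T ↦ B)) (ρc : G →* End c.pt)

/-- **`rk_ℤ Hom_G(A^G, B^T) = |T| · rk_ℤ Hom(A, B)`** for the regular power `A^G` and any permutation power `B^T`
(`|G\(G × T)| = |T|`; for `T = G/K`: `[G : K] · rk Hom(A, B)`). [cite: SerreLinearRepresentations1977, §7.2 Thm. 13 and §7.3 Prop. 22]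
[cite: MumfordAV1970, §19 Thm. 3 (p. 176)] -/
theorem finrank_equivariantHom_regularPower_permPower_eq (hb : ∑ x, b.π x ≫ b.ι x = 𝟙 b.pt)
    (hc : ∑ t, c.π t ≫ c.ι t = 𝟙 c.pt) (hρ : ∀ (g : G) (x : G), b.ι x ≫ End.asHom (ρ g) = b.ι (g • x))
    (hρc : ∀ (g : G) (t : T), c.ι t ≫ End.asHom (ρc g) = c.ι (g • t)) :
    Module.finrank ℤ (⨅ g : G, LinearMap.eqLocus (Preadditive.leftComp c.pt (End.asHom (ρ g))).toIntLinearMap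
        (Preadditive.rightComp b.pt (End.asHom (ρc g))).toIntLinearMap : Submodule ℤ (b.pt ⟶ c.pt)) =
      Nat.card T * Module.finrank ℤ (A ⟶ B) := by
  rw [finrank_equivariantHom_permPower_eq b c ρ ρc hb hc hρ hρc, natCard_quotient_orbitRel_regular_prod_eq]

end Regular

end AbelianVariety

end Literature.AlgebraicGeometry.Motives
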